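import Summits.QuantumFields.BalabanUV.Beta.FP.TorusOneShotColumnGaugeProjSym

/-!
# `BalabanUV.Beta.FP.TorusNestedGaugeReadout` — road «FP», binder row D1, ROUTE T (β1), STUB P (P-a) of the row's ONE file (an2 g76 A-2 l.68668, Q-an2-76-2; road W-4 l.68670):
# **THE END WRAPPER's GAUGE PARAMETER OF A SOURCE IS A READ-OUT OF THE ONE-SHOT CHART COLUMN THROUGH THE NESTED SLICE** —
# `(P·W₀)⁻¹·(P·hv v) = −(N·W₀)⁻¹·(N·(XN₁₂·(v,0)))`, `N := fromRows (τ₂·Q₁₀) τ₁` (the NESTED combs), so the wrapper's tree-gauge read-out `lv v = towerEvalC·θ_v` (pin `hlve`,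
# `θ_v := (P·W₀)⁻¹·(P·hv v)`) no longer mentions the nested direction `hv`: it is a finite linear read-out of the periodised one-shot chart column ALONE (v10's (T2) `hWΔT` then
# reads lattice-periodised factors only once the read-out is unwrapped — the row's STUB P (P-c); locality (P-b) is a reading, NOT typed here)

WHY (an2 g76 A-2 (2), agreed by the road W-4).  g39 `TorusOneShotColumnGaugeProj(Sym)`: `XN₁₂·(v,0) = hv v − W₀·θ_v` (the one-shot column is the gauge projection of the
nested column onto the one-shot slice `P`).  The nested column lies ON THE NESTED SLICE: `N·hv v = 0` — lit `CompositionSingular.mul_minOp` at both levels (`[Q₁₀;τ₁]·I = 1` gives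
`τ₁·hv = 0` and `Q₁₀·hv = minOp S₁₁ [Q₂₀;τ₂]·(v,0)`; `[Q₂₀;τ₂]·minOp S₁₁ [Q₂₀;τ₂] = 1` gives `τ₂·(Q₁₀·hv) = 0`).  Applying `N`: `N·XN₁₂(v,0) = −(N·W₀)·θ_v`, and `N·W₀` is
invertible (leaf-06 G-2 `torus_hTW_oneShot_towerSym`), hence the formula.

WHAT ([folklore] `Matrix` bookkeeping BY NAME; no `def`, no `def … : Prop`, nothing cited, 0 sorry):
§1 generic (`𝕜` a field, abstract blocks): **`nestedSlice_mulVec_nestedColumn_eq_zero`** (`N·hv = 0` from the two KKT non-degeneracies), **`gaugeParam_eq_neg_sliceReadout`** (pure algebra: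
a displayed projection identity `X = h − W·((P·W)⁻¹·(P·h))`, `N·h = 0`, `IsUnit (N·W).det` ⟹ `(P·W)⁻¹·(P·h) = −(N·W)⁻¹·(N·X)`), **`gaugeParam_eq_neg_nestedReadout`** (the two composed at
the wrapper's NAMINGS `hI hhv` with the projection identity, `h1 h2 hTW` DISPLAYED), `slice_mul_gaugeParam_eq_neg` ∕ **`nestedSlice_mul_gaugeParam_eq_neg`** (EQUATION FORM
`(N·W₀)·θ_v = −N·X v`, no invertibility — the form the pins take, whose one-shot slots `NParam … (n+1)` and nested slots `Res ⊕ NParam … n` agree only up to unfolding);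
§2 **`gaugeParam_eq_neg_nestedReadout_sym`** — AT THE END WRAPPER's PINS (binders = g39 `XN_toBlocks₁₂_mulVec_eq_gaugeProj_sym`'s VERBATIM + `h1 h2` displayed; the projection identity
by g39 `…_sym` BY NAME): `(N·W₀) *ᵥ ((P·W₀)⁻¹ *ᵥ (P *ᵥ hv v)) = −(N *ᵥ (XN.toBlocks₁₂ *ᵥ Sum.elim v 0))`, `N := fromRows (τ₂·Q₁₀) τ₁` (`N·W₀` invertible: leaf-06 G-2).
WHAT THIS IS NOT: not (P-b) (big-block locality of the read-out — a reading of `combBondT ∕ bigP ∕ towerGen ∕ towerEvalC`, road W-3 l.68665, untyped); not (P-c) (the lattice twin `λℤ` and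
its unwrapping — the row's); not `hlve`'s instantiation; no row of v9∕v10 discharged; nothing of Bałaban's asserted, valued or discharged; 0 estimates; 0∕4 row-D1 binders (hW, hR, D1Tel,
D1Rep); ROOT M‴ p325680 untouched; NOT (C1), NOT (L2′), NOT (T-ID), NOT SDF, NOT D1, NEVER «G-an2-4 closed», NOT BetaPertH, NOT continuum, NOT Clay.

HONEST DEPENDENCY (page 1, mandatory): continuum YM on T⁴ ⇐ BetaPertH ∧ nine spine estimates (0/9 proved); BetaPertH ⇐ (D1) ∧ (D4) ∧ CAP+tail;
G-an2-4 gates asym, D1 and NE2/3/4.  HONEST FRAMING (cell contract, verbatim): «discharging `BetaPertH` makes Bałaban's UV stability UNCONDITIONAL —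
a real constructive-QFT result; it is NOT the continuum limit and NOT the Clay problem.»  ABSOLUTE RULE (cell charter, verbatim): «No internally-minted
statement may enter as a cited fact. Every hypothesis is either kernel-proved in this package or a verbatim quotation of a PUBLISHED theorem with page
reference. The manuscript(s) under audit are NOT citable for their own disputed steps — they are the thing under adjudication; programme-internal
(2001/route/tribunal) claims are never citable.»  Road «FP» OWNER, b2b-balaban-beta-d1-p3 gen 53, 2026-08-28.  No existing file touched.
-/

noncomputable section

namespace Summit.QuantumFields.BalabanUV.Beta.FP.TorusNestedGaugeReadout

open Matrix Finset
open Literature.Probability.LatticeModels (Torus.proj)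
open Literature.MathematicalPhysics.QuantumFieldTheory.Balaban1983to89
open Literature.MathematicalPhysics.QuantumFieldTheory.Balaban1983to89.Beta
open Literature.MathematicalPhysics.QuantumFieldTheory.Balaban1983to89.Beta.Composition (kkt)
open Literature.MathematicalPhysics.QuantumFieldTheory.Balaban1983to89.Beta.CompositionSingular (effForm minOp)
open B5Prop11Plancherel (fine)
open B6Lemma24Torus (pbox)
open AffineAveraging (Site box toSite)
open AveragingContoursRooted (ctrOff ctrOff_mem_box)
open OneStepResolventKernel (Fib)
open Summit.QuantumFields.BalabanUV.Beta.SymShiftedSpread (bhKStepSh)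
open Summit.QuantumFields.BalabanUV.Beta.BorderedHessian (bhKStepAt)
open Summit.QuantumFields.BalabanUV.Beta.DshAn1 (Dsh)
open Summit.QuantumFields.BalabanUV.Beta.FP.KernelPeriodisationFib (Idx perF perF_apply perZ_apply)
open Summit.QuantumFields.BalabanUV.Beta.FP.TorusCombRows (Res)
open Summit.QuantumFields.BalabanUV.Beta.FP.TorusCompositeObjects (towerTorus NParam combF bigP towerGen)
open Summit.QuantumFields.BalabanUV.Beta.FP.TorusCompositeObjectsG (QSym compRowsSym)
open Summit.QuantumFields.BalabanUV.Beta.FP.TorusCompositeSliceG (det_nestedSliceSym_mul_towerGen_ne_zero)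
open Summit.QuantumFields.BalabanUV.Beta.FP.TorusCompositeSliceOneShotG (torus_hTW_oneShot_towerSym)
open Summit.QuantumFields.BalabanUV.Beta.FP.TorusCompositeCovarianceSym (compRowsSym_mul_towerGen_succ QtopSym_mul_smul_tgrad_res)
open Summit.QuantumFields.BalabanUV.Beta.FP.RelInvPeriodisedCombTorusLetters (torus_h1_comb hId_comb torus_H₀_transpose_comb)
open Summit.QuantumFields.BalabanUV.Beta.FP.RelInvPeriodisedCombRecord (torus_isUnit_det_kkt_combRows_comb)
open Summit.QuantumFields.BalabanUV.Beta.FP.NestedStepLawTorusComposite (dvd_towerTorus_succ)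
open Summit.QuantumFields.BalabanUV.Beta.FP.NestedStepLawTorusCompositeOneShot (torus_a0_tower)
open Summit.QuantumFields.BalabanUV.Beta.FP.NestedStepLawTorusCompositeOneShotTopSym (bhKStepSh_Dsh_inl_inl_eq_bhKStepAt)
open Summit.QuantumFields.BalabanUV.Beta.FP.NestedStepLawTorusInstance (dvd_fine)
open Summit.QuantumFields.BalabanUV.Beta.GAN24.FineReadoutCauchyFrame (toSite_mem_range)
open Summit.QuantumFields.BalabanUV.Beta.FP.TorusOneShotColumnGaugeProjG (XN_toBlocks₁₂_mulVec_eq_gaugeProj_G)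
open Literature.MathematicalPhysics.QuantumFieldTheory.Balaban1983to89.Beta.CompositionSingular (mul_minOp)
open Summit.QuantumFields.BalabanUV.Beta.FP.TorusOneShotColumnGaugeProjSym (XN_toBlocks₁₂_mulVec_eq_gaugeProj_sym)

variable {d : ℕ}

/-! ## §1 Generic: the nested column lies on the nested slice; the one-shot gauge parameter through the nested slice -/

section Generic

variable {𝕜 : Type*} [Field 𝕜] {ν μ κ ρ₁ ρ₂ σ : Type*} [Fintype ν] [Fintype μ] [Fintype κ] [Fintype ρ₁] [Fintype ρ₂] [Fintype σ]
  [DecidableEq ν] [DecidableEq μ] [DecidableEq κ] [DecidableEq ρ₁] [DecidableEq ρ₂] [DecidableEq σ]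

/-- [folklore] **THE NESTED COLUMN LIES ON THE NESTED SLICE**: `[τ₂·Q₁; τ₁] · (minOp H [Q₁;τ₁] · (minOp S₁₁ [Q₂;τ₂] · (v,0), 0)) = 0` — the constraint rows reproduce
the data (lit `mul_minOp` at both levels): the lower comb rows `τ₁` read the `0` of the lower data, the top comb rows `τ₂` read, through `Q₁`, the `0` of the top data. -/
theorem nestedSlice_mulVec_nestedColumn_eq_zero (H : Matrix ν ν 𝕜) (Q₁ : Matrix μ ν 𝕜) (τ₁ : Matrix ρ₁ ν 𝕜) (Q₂ : Matrix κ μ 𝕜) (τ₂ : Matrix ρ₂ μ 𝕜)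
    (S₁₁ : Matrix μ μ 𝕜) (h1 : IsUnit (kkt H (fromRows Q₁ τ₁)).det) (h2 : IsUnit (kkt S₁₁ (fromRows Q₂ τ₂)).det) (v : κ → 𝕜) :
    fromRows (τ₂ * Q₁) τ₁ *ᵥ (minOp H (fromRows Q₁ τ₁) *ᵥ Sum.elim (minOp S₁₁ (fromRows Q₂ τ₂) *ᵥ Sum.elim v 0) 0) = 0 := by
  have e1 : fromRows Q₁ τ₁ *ᵥ (minOp H (fromRows Q₁ τ₁) *ᵥ Sum.elim (minOp S₁₁ (fromRows Q₂ τ₂) *ᵥ Sum.elim v 0) 0)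
      = Sum.elim (minOp S₁₁ (fromRows Q₂ τ₂) *ᵥ Sum.elim v 0) 0 := by
    rw [mulVec_mulVec, mul_minOp H (fromRows Q₁ τ₁) h1, one_mulVec]
  have e2 : fromRows Q₂ τ₂ *ᵥ (minOp S₁₁ (fromRows Q₂ τ₂) *ᵥ Sum.elim v 0) = Sum.elim v 0 := by
    rw [mulVec_mulVec, mul_minOp S₁₁ (fromRows Q₂ τ₂) h2, one_mulVec]
  rw [fromRows_mulVec] at e1 e2
  have hQ₁ : Q₁ *ᵥ (minOp H (fromRows Q₁ τ₁) *ᵥ Sum.elim (minOp S₁₁ (fromRows Q₂ τ₂) *ᵥ Sum.elim v 0) 0) = minOp S₁₁ (fromRows Q₂ τ₂) *ᵥ Sum.elim v 0 := by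
    funext i; simpa using congrFun e1 (Sum.inl i)
  have hτ₁ : τ₁ *ᵥ (minOp H (fromRows Q₁ τ₁) *ᵥ Sum.elim (minOp S₁₁ (fromRows Q₂ τ₂) *ᵥ Sum.elim v 0) 0) = 0 := by
    funext i; simpa using congrFun e1 (Sum.inr i)
  have hτ₂ : τ₂ *ᵥ (minOp S₁₁ (fromRows Q₂ τ₂) *ᵥ Sum.elim v 0) = 0 := by
    funext i; simpa using congrFun e2 (Sum.inr i)
  rw [fromRows_mulVec, ← mulVec_mulVec, hQ₁, hτ₂, hτ₁]
  funext i; rcases i with i | i <;> rfl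

omit [DecidableEq ν] in
/-- [folklore] **THE GAUGE PARAMETER SEEN THROUGH ANOTHER SLICE, EQUATION FORM** (pure algebra, no invertibility): from a displayed projection identity
`X = h − W·((P·W)⁻¹·(P·h))` and `N·h = 0`: `(N·W)·((P·W)⁻¹·(P·h)) = −N·X`. -/
theorem slice_mul_gaugeParam_eq_neg {X h : ν → 𝕜} {W : Matrix ν σ 𝕜} {P N : Matrix σ ν 𝕜}
    (hX : X = h - W *ᵥ ((P * W)⁻¹ *ᵥ (P *ᵥ h))) (hNh : N *ᵥ h = 0) :
    (N * W) *ᵥ ((P * W)⁻¹ *ᵥ (P *ᵥ h)) = -(N *ᵥ X) := by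
  rw [hX, mulVec_sub, hNh, zero_sub, neg_neg, ← mulVec_mulVec]

omit [DecidableEq ν] in
/-- [folklore] **THE GAUGE PARAMETER THROUGH ANOTHER SLICE** (pure algebra): from a displayed projection identity `X = h − W·((P·W)⁻¹·(P·h))`, `N·h = 0` and
`IsUnit (N·W).det`: `(P·W)⁻¹·(P·h) = −(N·W)⁻¹·(N·X)` (apply `N`, invert `N·W`). -/
theorem gaugeParam_eq_neg_sliceReadout {X h : ν → 𝕜} {W : Matrix ν σ 𝕜} {P N : Matrix σ ν 𝕜}
    (hX : X = h - W *ᵥ ((P * W)⁻¹ *ᵥ (P *ᵥ h))) (hNh : N *ᵥ h = 0) (hT : IsUnit (N * W).det) :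
    (P * W)⁻¹ *ᵥ (P *ᵥ h) = -((N * W)⁻¹ *ᵥ (N *ᵥ X)) := by
  have e : N *ᵥ X = -((N * W) *ᵥ ((P * W)⁻¹ *ᵥ (P *ᵥ h))) := by
    rw [hX, mulVec_sub, hNh, zero_sub, mulVec_mulVec]
  rw [e, mulVec_neg, neg_neg]
  conv_rhs => rw [mulVec_mulVec, nonsing_inv_mul _ hT, one_mulVec]

/-- [folklore] **`gaugeParam_eq_neg_nestedReadout` — AT THE WRAPPER's NAMINGS**: for the nested direction `hv v = I·(minOp S₁₁ [Q₂₀;τ₂]·(v,0), 0)` (`hhv`, `hI`), a displayed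
projection identity `X v = hv v − W₀·((P·W₀)⁻¹·(P·hv v))` (`hgp`; g39's conclusion), the nested KKT non-degeneracies `h1 h2` and `hTW : det (N·W₀) ≠ 0` (`N := fromRows (τ₂·Q₁₀) τ₁`):
`(P·W₀)⁻¹·(P·hv v) = −(N·W₀)⁻¹·(N·X v)`. -/
theorem gaugeParam_eq_neg_nestedReadout
    {H₀ : Matrix ν ν 𝕜} {Q₁₀ : Matrix μ ν 𝕜} {τ₁ : Matrix ρ₁ ν 𝕜} {Q₂₀ : Matrix κ μ 𝕜} {τ₂ : Matrix ρ₂ μ 𝕜}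
    {W₀ : Matrix ν (ρ₂ ⊕ ρ₁) 𝕜} {P : Matrix (ρ₂ ⊕ ρ₁) ν 𝕜} {I : Matrix ν (μ ⊕ ρ₁) 𝕜} {S : Matrix (μ ⊕ ρ₁) (μ ⊕ ρ₁) 𝕜}
    (hI : minOp H₀ (fromRows Q₁₀ τ₁) = I)
    {hv : (κ → 𝕜) → (ν → 𝕜)} (hhv : ∀ v, hv v = I *ᵥ Sum.elim (minOp S.toBlocks₁₁ (fromRows Q₂₀ τ₂) *ᵥ Sum.elim v 0) 0)
    {X : (κ → 𝕜) → (ν → 𝕜)} (hgp : ∀ v, X v = hv v - W₀ *ᵥ ((P * W₀)⁻¹ *ᵥ (P *ᵥ hv v)))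
    (h1 : (kkt H₀ (fromRows Q₁₀ τ₁)).det ≠ 0) (h2 : (kkt S.toBlocks₁₁ (fromRows Q₂₀ τ₂)).det ≠ 0)
    (hTW : (fromRows (τ₂ * Q₁₀) τ₁ * W₀).det ≠ 0) (v : κ → 𝕜) :
    (P * W₀)⁻¹ *ᵥ (P *ᵥ hv v) = -((fromRows (τ₂ * Q₁₀) τ₁ * W₀)⁻¹ *ᵥ (fromRows (τ₂ * Q₁₀) τ₁ *ᵥ X v)) :=
  gaugeParam_eq_neg_sliceReadout (hgp v)
    (by rw [hhv v, ← hI]; exact nestedSlice_mulVec_nestedColumn_eq_zero H₀ Q₁₀ τ₁ Q₂₀ τ₂ S.toBlocks₁₁ (isUnit_iff_ne_zero.mpr h1) (isUnit_iff_ne_zero.mpr h2) v)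
    (isUnit_iff_ne_zero.mpr hTW)

/-- [folklore] **`nestedSlice_mul_gaugeParam_eq_neg` — THE SAME IN EQUATION FORM, NO INVERTIBILITY**: `(N·W₀)·((P·W₀)⁻¹·(P·hv v)) = −N·(X v)`, `N := fromRows (τ₂·Q₁₀) τ₁`
(the form the wrapper's pins take, whose one-shot slots `NParam … (n+1)` and nested slots `Res ⊕ NParam … n` agree only up to unfolding; `N·W₀` is invertible by leaf-06 G-2
`torus_hTW_oneShot_towerSym`, so this DETERMINES the gauge parameter). -/
theorem nestedSlice_mul_gaugeParam_eq_neg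
    {H₀ : Matrix ν ν 𝕜} {Q₁₀ : Matrix μ ν 𝕜} {τ₁ : Matrix ρ₁ ν 𝕜} {Q₂₀ : Matrix κ μ 𝕜} {τ₂ : Matrix ρ₂ μ 𝕜}
    {W₀ : Matrix ν (ρ₂ ⊕ ρ₁) 𝕜} {P : Matrix (ρ₂ ⊕ ρ₁) ν 𝕜} {I : Matrix ν (μ ⊕ ρ₁) 𝕜} {S : Matrix (μ ⊕ ρ₁) (μ ⊕ ρ₁) 𝕜}
    (hI : minOp H₀ (fromRows Q₁₀ τ₁) = I)
    {hv : (κ → 𝕜) → (ν → 𝕜)} (hhv : ∀ v, hv v = I *ᵥ Sum.elim (minOp S.toBlocks₁₁ (fromRows Q₂₀ τ₂) *ᵥ Sum.elim v 0) 0)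
    {X : (κ → 𝕜) → (ν → 𝕜)} (hgp : ∀ v, X v = hv v - W₀ *ᵥ ((P * W₀)⁻¹ *ᵥ (P *ᵥ hv v)))
    (h1 : (kkt H₀ (fromRows Q₁₀ τ₁)).det ≠ 0) (h2 : (kkt S.toBlocks₁₁ (fromRows Q₂₀ τ₂)).det ≠ 0) (v : κ → 𝕜) :
    (fromRows (τ₂ * Q₁₀) τ₁ * W₀) *ᵥ ((P * W₀)⁻¹ *ᵥ (P *ᵥ hv v)) = -(fromRows (τ₂ * Q₁₀) τ₁ *ᵥ X v) :=
  slice_mul_gaugeParam_eq_neg (hgp v)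
    (by rw [hhv v, ← hI]; exact nestedSlice_mulVec_nestedColumn_eq_zero H₀ Q₁₀ τ₁ Q₂₀ τ₂ S.toBlocks₁₁ (isUnit_iff_ne_zero.mpr h1) (isUnit_iff_ne_zero.mpr h2) v)

end Generic

/-! ## §2 At the END wrapper's pins: the projection identity and `hTW` by name -/

section RecordSym

variable (M' : Fin (d + 1) → ℕ) [∀ μ, NeZero (M' μ)] (Lc : ℕ) [NeZero Lc] (lev : ℕ → ℕ) (n : ℕ)

set_option synthInstance.maxSize 1024 in
/-- [folklore] **`gaugeParam_eq_neg_nestedReadout_sym` — THE WRAPPER's GAUGE PARAMETER IS A NESTED-SLICE READ-OUT OF THE ONE-SHOT CHART COLUMN, AT THE PINS**: binders = g39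
`XN_toBlocks₁₂_mulVec_eq_gaugeProj_sym`'s VERBATIM + the nested KKT non-degeneracies `h1 h2` (displayed); the projection identity by g39 `…_sym` BY NAME.  CONCLUSION (equation
form; `N·W₀` is invertible by leaf-06 G-2 `torus_hTW_oneShot_towerSym`, so it determines `θ_v`): `(N·W₀) *ᵥ ((P·W₀)⁻¹ *ᵥ (P *ᵥ hv v)) = −(N *ᵥ (XN.toBlocks₁₂ *ᵥ Sum.elim v 0))`. -/
theorem gaugeParam_eq_neg_nestedReadout_sym
    (hrs : ∀ _k : ℕ, ctrOff (d + 1) Lc ∈ box (d + 1) Lc)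
    (hlev : ∀ i, i ≤ n → lev i = lev (i + 1) + 1) (hM' : ∀ i, Lc ∣ M' i)
    {κ : Type*} [Fintype κ] [DecidableEq κ] (pμ' : κ → ↥(pbox M')) (mμ' : κ → Fin (d + 1))
    (hfμ' : Function.Injective (fun a : κ => ((pμ' a, Sum.inr (mμ' a)) : Idx M' (Fib d))))
    (hcoarse' : ∀ (s : ↥(pbox M')) (m : Fin (d + 1)),
      ((s, Sum.inr m) : Idx M' (Fib d)) ∈ Set.range (fun a : κ => ((pμ' a, Sum.inr (mμ' a)) : Idx M' (Fib d))) ↔ Torus.proj Lc (s : Site (d + 1)) = 0)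
    {H₀ : Matrix (↥(pbox (towerTorus Lc M' (n + 1))) × Fin (d + 1)) (↥(pbox (towerTorus Lc M' (n + 1))) × Fin (d + 1)) ℝ}
    {Q₁₀ : Matrix (↥(pbox M') × Fin (d + 1)) (↥(pbox (towerTorus Lc M' (n + 1))) × Fin (d + 1)) ℝ}
    {τ₁ : Matrix (NParam Lc (fine Lc M') (fun k => (fun _ : ℕ => ctrOff (d + 1) Lc) (k + 1)) n) (↥(pbox (towerTorus Lc M' (n + 1))) × Fin (d + 1)) ℝ}
    (hH₀ : H₀ = (perF (towerTorus Lc M' (n + 1)) (bhKStepSh d Lc (Dsh Lc) (lev (n + 1)))).submatrix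
        (fun b : ↥(pbox (towerTorus Lc M' (n + 1))) × Fin (d + 1) => ((b.1, Sum.inl b.2) : Idx (towerTorus Lc M' (n + 1)) (Fib d)))
        (fun b : ↥(pbox (towerTorus Lc M' (n + 1))) × Fin (d + 1) => ((b.1, Sum.inl b.2) : Idx (towerTorus Lc M' (n + 1)) (Fib d))))
    (hQ₁₀ : Q₁₀ = compRowsSym Lc M' lev (fun _ : ℕ => ctrOff (d + 1) Lc) (n + 1))
    (hτ₁ : τ₁ = bigP Lc (fine Lc M') (fun k => (fun _ : ℕ => ctrOff (d + 1) Lc) (k + 1)) (fun k => toSite_mem_range (hrs (k + 1))) n)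
    {τ₂ : Matrix (Res (toSite (ctrOff (d + 1) Lc)) Lc M') (↥(pbox M') × Fin (d + 1)) ℝ} (hτ₂ : τ₂ = combF Lc M' ((fun _ : ℕ => ctrOff (d + 1) Lc) 0))
    {Q₂₀ : Matrix κ (↥(pbox M') × Fin (d + 1)) ℝ}
    (hQ₂₀ : Q₂₀ = (perF M' (bhKStepSh d Lc (Dsh Lc) (lev 0))).submatrix (fun a : κ => ((pμ' a, Sum.inr (mμ' a)) : Idx M' (Fib d)))
        (fun b : ↥(pbox M') × Fin (d + 1) => ((b.1, Sum.inl b.2) : Idx M' (Fib d))))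
    {W₀ : Matrix (↥(pbox (towerTorus Lc M' (n + 1))) × Fin (d + 1)) (NParam Lc M' (fun _ : ℕ => ctrOff (d + 1) Lc) (n + 1)) ℝ}
    (hW₀ : W₀ = towerGen Lc M' (fun _ : ℕ => ctrOff (d + 1) Lc) (n + 1))
    {P : Matrix (NParam Lc M' (fun _ : ℕ => ctrOff (d + 1) Lc) (n + 1)) (↥(pbox (towerTorus Lc M' (n + 1))) × Fin (d + 1)) ℝ}
    (hP : P = bigP Lc M' (fun _ : ℕ => ctrOff (d + 1) Lc) (fun k => toSite_mem_range (hrs k)) (n + 1))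
    {𝔔₀ : Matrix κ (↥(pbox (towerTorus Lc M' (n + 1))) × Fin (d + 1)) ℝ} (h𝔔₀ : Q₂₀ * Q₁₀ = 𝔔₀)
    {I : Matrix (↥(pbox (towerTorus Lc M' (n + 1))) × Fin (d + 1))
      ((↥(pbox M') × Fin (d + 1)) ⊕ NParam Lc (fine Lc M') (fun k => (fun _ : ℕ => ctrOff (d + 1) Lc) (k + 1)) n) ℝ}
    {S : Matrix ((↥(pbox M') × Fin (d + 1)) ⊕ NParam Lc (fine Lc M') (fun k => (fun _ : ℕ => ctrOff (d + 1) Lc) (k + 1)) n)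
      ((↥(pbox M') × Fin (d + 1)) ⊕ NParam Lc (fine Lc M') (fun k => (fun _ : ℕ => ctrOff (d + 1) Lc) (k + 1)) n) ℝ}
    (hI : minOp H₀ (fromRows Q₁₀ τ₁) = I) (hS : effForm H₀ (fromRows Q₁₀ τ₁) = S)
    {hv : (κ → ℝ) → ((↥(pbox (towerTorus Lc M' (n + 1))) × Fin (d + 1)) → ℝ)}
    (hhv : ∀ v, hv v = I *ᵥ Sum.elim (minOp S.toBlocks₁₁ (fromRows Q₂₀ τ₂) *ᵥ Sum.elim v 0) 0)
    {XN : Matrix ((↥(pbox (towerTorus Lc M' (n + 1))) × Fin (d + 1)) ⊕ (κ ⊕ NParam Lc M' (fun _ : ℕ => ctrOff (d + 1) Lc) (n + 1)))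
      ((↥(pbox (towerTorus Lc M' (n + 1))) × Fin (d + 1)) ⊕ (κ ⊕ NParam Lc M' (fun _ : ℕ => ctrOff (d + 1) Lc) (n + 1))) ℝ}
    (hXN : kkt H₀ (fromRows 𝔔₀ P) * XN = 1) 
    -- the two KKT non-degeneracies of the NESTED system (displayed; at the wrapper `h1` is `Matrix.isUnit_det_of_right_inverse` on the F leg `hXF`, `h2` is #21-GB's (EFF) line)
    (h1 : (kkt H₀ (fromRows Q₁₀ τ₁)).det ≠ 0) (h2 : (kkt S.toBlocks₁₁ (fromRows Q₂₀ τ₂)).det ≠ 0) (v : κ → ℝ) :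
    (fromRows (τ₂ * Q₁₀) τ₁ * W₀) *ᵥ ((P * W₀)⁻¹ *ᵥ (P *ᵥ hv v)) = -(fromRows (τ₂ * Q₁₀) τ₁ *ᵥ (XN.toBlocks₁₂ *ᵥ Sum.elim v 0)) :=
  nestedSlice_mul_gaugeParam_eq_neg hI hhv
    (fun w => XN_toBlocks₁₂_mulVec_eq_gaugeProj_sym M' Lc lev n hrs hlev hM' pμ' mμ' hfμ' hcoarse' hH₀ hQ₁₀ hτ₁ hτ₂ hQ₂₀ hW₀ hP h𝔔₀ hI hS hhv hXN w)
    h1 h2 v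

end RecordSym

end Summit.QuantumFields.BalabanUV.Beta.FP.TorusNestedGaugeReadout

end
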